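import Literature.MathematicalPhysics.AQFT.OSAxiomsSchwinger
import Literature.MathematicalPhysics.QuantumLattice.SchwingerOSPositivity
import HarnessLib

/-!
# Soft OS-assembly toolkit XXII: hermiticity from reflection positivity and normalisation

Helper file for stub `stub_assembly6` of crux `OSLegsFromFemtoAndGap` (stmt-QuantumFields-9367, line
`dlr-collar-transfer`, reshape r2).  KQR Remark 2.2 made formal for one-field families: if `S₁` is normalised
(E0) and reflection positive (E2) then it is Hermitian, `S₁ₙ(F) = conj S₁ₙ(ΘF*)` for time-ordered `F`
(`isHermitian_of_isReflectionPositive`).  Proof: apply E2 to the two-term tuple `(c·𝟙₀, F)`; the OS form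
`|c|² + c̄·S(F) + c·S(ΘF*) + S(ΘF* ⊗ F)` is real for `c = 0, 1, i`, which forces `S(ΘF*) = conj S(F)`.  The only
technical point is the arity `0 + n` of the cross term, transported along `Fin (0 + n) ≃ Fin n` (`castTest`).
-/

noncomputable section

open scoped SchwartzMap BigOperators ComplexConjugate
open Filter Topology
open Literature.MathematicalPhysics.QuantumLattice Literature.MathematicalPhysics.AQFT

namespace Summit.QuantumFields.YangMills.Theorems.OSLegsFromFemtoAndGap

local notation "E4" => EuclideanSpace ℝ (Fin 4)

/-! ### Transport of test functions along `Fin m ≃ Fin m'` -/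

/-- Reindexing the arguments of a test function along `m = m'`. -/
def castTest {m m' : ℕ} (h : m = m') (G : 𝓢((Fin m → E4), ℂ)) : 𝓢((Fin m' → E4), ℂ) :=
  SchwartzMap.compCLMOfContinuousLinearEquiv ℂ
    ((LinearEquiv.funCongrLeft ℝ E4 (finCongr h)).toContinuousLinearEquiv) G

/-- Pointwise formula for `castTest`. -/
theorem castTest_apply {m m' : ℕ} (h : m = m') (G : 𝓢((Fin m → E4), ℂ)) (x : Fin m' → E4) :
    castTest h G x = G (fun a => x (Fin.cast h a)) := rfl

/-- **A Schwinger family does not see the reindexing** `Fin m ≃ Fin m'` of equal arities. -/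
theorem schwinger_castTest (S₁ : SchwingerFamily E4) {m m' : ℕ} (h : m = m') (G : 𝓢((Fin m → E4), ℂ)) :
    S₁ m G = S₁ m' (castTest h G) := by
  subst h
  congr 1

/-! ### The constant test function of arity zero -/

/-- The constant of arity `0` is time-ordered (vacuously). -/
theorem isTimeOrdered_const (c : ℂ) :
    IsTimeOrdered (SchwartzMap.constOfSubsingleton (D := Fin 0 → E4) c) := by
  intro x _
  exact ⟨fun i => Fin.elim0 i, fun i => Fin.elim0 i⟩

/-- The OS adjoint of the constant of arity `0`. -/
theorem osAdjoint_const_apply (c : ℂ) (x : Fin 0 → E4) :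
    osAdjoint (SchwartzMap.constOfSubsingleton (D := Fin 0 → E4) c) x = conj c := by
  rw [osAdjoint_apply, SchwartzMap.constOfSubsingleton_apply]

/-! ### Hermiticity -/

/-- **Hermiticity from E0 + E2** (KQR Remark 2.2) for one-field Schwinger families. -/
theorem isHermitian_of_isReflectionPositive (S₁ : SchwingerFamily E4) (hN : S₁.toLabelled.IsNormalized)
    (hRP : S₁.toLabelled.IsReflectionPositive) : S₁.toLabelled.IsHermitian := by
  intro n k F hF
  simp only [SchwingerFamily.toLabelled_apply]
  -- the two-term tuple `(c·𝟙₀, F)` and its OS form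
  have key : ∀ c : ℂ, (conj c * c + conj c * S₁ n F + c * S₁ n (osAdjoint F) +
      S₁ (n + n) ((osAdjoint F).appendTensor F)).im = 0 := by
    intro c
    let deg : Fin 2 → ℕ := Fin.cons 0 fun _ => n
    let F' : (j : Fin 2) → 𝓢((Fin (deg j) → E4), ℂ) :=
      Fin.cons (α := fun j : Fin 2 => 𝓢((Fin (deg j) → E4), ℂ))
        (SchwartzMap.constOfSubsingleton (D := Fin 0 → E4) c) fun _ => F
    have hF'0 : F' 0 = SchwartzMap.constOfSubsingleton (D := Fin 0 → E4) c := rfl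
    have hF'1 : F' 1 = F := rfl
    have hTO : ∀ j, IsTimeOrdered (F' j) := fun j => Fin.cases (isTimeOrdered_const c) (fun _ => hF) j
    have h := hRP 2 deg (fun _ _ => ()) F' hTO (fun i j => (osAdjoint (F' i)).appendTensor (F' j))
      (fun i j x => SchwartzMap.appendTensor_apply _ _ x)
    simp only [SchwingerFamily.toLabelled_apply, Fin.sum_univ_two] at h
    -- identify the four terms
    have h00 : S₁ (deg 0 + deg 0) ((osAdjoint (F' 0)).appendTensor (F' 0)) = conj c * c := by
      have e := hN (fun _ => ()) ((osAdjoint (F' 0)).appendTensor (F' 0))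
      rw [SchwingerFamily.toLabelled_apply] at e
      refine e.trans ((SchwartzMap.appendTensor_apply _ _ _).trans ?_)
      change osAdjoint (SchwartzMap.constOfSubsingleton (D := Fin 0 → E4) c) _ *
        SchwartzMap.constOfSubsingleton (D := Fin 0 → E4) c _ = _
      rw [osAdjoint_const_apply, SchwartzMap.constOfSubsingleton_apply]
    have h01 : S₁ (deg 0 + deg 1) ((osAdjoint (F' 0)).appendTensor (F' 1)) = conj c * S₁ n F := by
      refine (schwinger_castTest S₁ (m := 0 + n) (Nat.zero_add n) ((osAdjoint (F' 0)).appendTensor (F' 1))).trans ?_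
      have hG : castTest (Nat.zero_add n) ((osAdjoint (F' 0)).appendTensor (F' 1)) = conj c • F := by
        ext x
        refine (SchwartzMap.appendTensor_apply _ _ _).trans ?_
        change osAdjoint (SchwartzMap.constOfSubsingleton (D := Fin 0 → E4) c) _ * F _ = _
        rw [osAdjoint_const_apply, smul_apply, smul_eq_mul]
        congr 1
        congr 1
        funext i
        simp only [Function.comp_apply]
        change x (Fin.cast (Nat.zero_add n) (Fin.natAdd 0 i)) = x i
        congr 1
        refine Fin.ext ?_
        rw [Fin.val_cast, Fin.val_natAdd]
        exact Nat.zero_add _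
      rw [hG, map_smul, smul_eq_mul]
    have h10 : S₁ (deg 1 + deg 0) ((osAdjoint (F' 1)).appendTensor (F' 0)) = c * S₁ n (osAdjoint F) := by
      refine (schwinger_castTest S₁ (m := n + 0) (Nat.add_zero n) ((osAdjoint (F' 1)).appendTensor (F' 0))).trans ?_
      have hG : castTest (Nat.add_zero n) ((osAdjoint (F' 1)).appendTensor (F' 0)) = c • osAdjoint F := by
        ext x
        refine (SchwartzMap.appendTensor_apply _ _ _).trans ?_
        change osAdjoint F _ * SchwartzMap.constOfSubsingleton (D := Fin 0 → E4) c _ = _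
        rw [SchwartzMap.constOfSubsingleton_apply, smul_apply, smul_eq_mul, mul_comm]
        rfl
      rw [hG, map_smul, smul_eq_mul]
    have h11 : S₁ (deg 1 + deg 1) ((osAdjoint (F' 1)).appendTensor (F' 1)) =
        S₁ (n + n) ((osAdjoint F).appendTensor F) := rfl
    rw [h00, h01, h10, h11] at h
    have := h.2
    rw [show conj c * c + conj c * S₁ n F + (c * S₁ n (osAdjoint F) + S₁ (n + n) ((osAdjoint F).appendTensor F)) =
      conj c * c + conj c * S₁ n F + c * S₁ n (osAdjoint F) + S₁ (n + n) ((osAdjoint F).appendTensor F) by ring] at this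
    exact this
  have k0 := key 0
  have k1 := key 1
  have kI := key Complex.I
  simp only [map_zero, map_one, Complex.conj_I, zero_mul, mul_zero, zero_add, one_mul, neg_mul,
    Complex.add_im, Complex.neg_im, Complex.mul_im, Complex.I_re, Complex.I_im,
    Complex.one_im, mul_one, add_zero] at k0 k1 kI
  apply Complex.ext
  · rw [Complex.conj_re]; linarith
  · rw [Complex.conj_im]; linarith

end Summit.QuantumFields.YangMills.Theorems.OSLegsFromFemtoAndGap

end
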